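/-
Origin: expansion seat `prover-pub-hodgecm-mc-sinst-1-0`, handover #1202 2026-08-19T22:32Z md5 8b80e331e4a9a98da61430cdd707f9d4 (232 l.) NEW additive leaf; row 13 hT hypothesis-free at the term/family via adelicMpCont.isLFContinuous_omega + collapse p194071; install after #1201 + the Collapse K-1 twin (glue-2 v30); drop alone on bounce (`HOME/mc/pub-hodgecm-mc-sinst-1/stage/HodgeCM/Model/ThetaAdelicSideLF.lean`, md5 8b80e331, 232 lines);
landed by the gen-13 packager (p-g13) in gate run 37 as `HodgeCM/Model/ThetaAdelicSideLF.lean` (verbatim).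
-/
/-
HodgeCM/Model/ThetaAdelicSideLF.lean — sinst-1 lane (unit pub-hodgecm-mc-sinst-1, seat prover-pub-hodgecm-mc-sinst-1-0, 2026-08-19),
BINDER-OWNERS row 13 `hT` AT THE HONEST S TERM / FAMILY: the honest-branch input `hLF` of `HodgeCM/Model/ThetaAdelicSideInstance.lean` §3
DISCHARGED — the four S-side line representations `lineRepD … k` act by LF-continuous operators.

Route (kernel, nothing cited as a hypothesis): the tree's collapse lemmas `cmLineRepFin₀/₁_apply_eq_smul_cmPairRep`,
`cmConjLineRepFin₀/₁_apply_eq_smul_cmPairRep` (p194071 `GelbartRogawski1991/UnitaryDualPairSeesawCMLinesCollapse`, [Howe1979 §3;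
GelbartRogawski1991 §3.1 Remark p. 457]) give, pointwise in the group, `lineRepD k (v,t) = c_k(v,t) • cmPairRep e₁ hGR_k (v, centre u)`;
`cmPairRep … p = ω_ψ(s_pair p)` (`cmPairRep_apply`, rfl) is the oscillator action of an element of the metaplectic group OF RECORD
`Mp_ψ(W_𝔸)ᶜᵒⁿᵗ`, LF-continuous BY DEFINITION (`adelicMpCont.isLFContinuous_omega`, tree `Weil1964/AdelicMetaplecticContinuous`
[Weil1964, Chap. I n° 11–13; GelbartRogawski1991 §3.1 p. 454]); scalar multiples of LF-continuous operators are LF-continuous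
(`isLFContinuous_smul_of`, here).  Hence:

* `isLFContinuous_cmPairRep` — every `cmPairRep … p` is LF-continuous;
* `ArchSideTerm.isLFContinuous_lineRep` / `isLFContinuous_lineRepOf` / **`isLFContinuous_lineRepD`** — the four line representations;
* **`ArchSideTerm.isLFAction_archSideOf` / `isThetaArchContinuous_archSideOf`** — rows `hLF` (R17A) / 13 `hT` (R15A) AT period-1's term
  `archSideOf V c … h₁W A` (for binder-1's `Gen12Pins.S` users);
* **`ArchSideTerm.isLFAction_thetaAdelicSideOf` / `isThetaArchContinuous_thetaAdelicSideOf`** — the same at the TOTAL term (both branches);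
* **`SInstance.hLF` / `SInstance.hT`** — E's binders `hLF` / `hT` in their literal quantifier shapes at the family `SInstance.S …`,
  HYPOTHESIS-FREE given the family inputs (`hGR×5`, `η hη hηc`, theta-3's `A`).

Imports `ThetaAdelicSideInstance` + the K-1 twin of the Collapse file (glue-2; a provisional private twin of the ACCEPTED tree file is used
for the private certificate until the twin of record is vended).  KERNEL ONLY: 0 records, 0 `def … : Prop`, MODEL-N ±0, E TYPE ±0.
-/
import Summits.HodgeConjecture.HodgeCM.Model.ThetaAdelicSideInstance
import Literature.NumberTheory.GelbartRogawski1991.UnitaryDualPairSeesawCMLinesCollapse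

set_option autoImplicit false

noncomputable section

open scoped Matrix SchwartzMap TensorProduct
open NumberField NumberField.mixedEmbedding
open Literature.NumberTheory.Automorphic Literature.NumberTheory.Weil1964
open Literature.NumberTheory.GelbartRogawski1991.UnitaryDualPair
open HodgeCM.Adelic HodgeCM.PerL34
open Literature.Geometry.ComplexHyperbolic.BallModel (U21)
open Literature.AlgebraicGeometry.HodgeTheory
open Literature.NumberTheory.Automorphic.PicardCM

namespace HodgeCM.Model

/-! ## §1 Two closure properties of LF-continuity -/

section LF

variable {K : Type} [Field K] [NumberField K] {ι : Type} [Fintype ι]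

/-- **Scalar multiples of LF-continuous operators are LF-continuous** (the expansion of `c • M` on a Fréchet piece is `∑ (c • A_j) φ ⊗ Ψ_j`).
(Named `_smul_of` to stay clear of the tree's `Literature.NumberTheory.Automorphic.isLFContinuous_smul : IsLFContinuous (c • id)`,
`Weil1964/AdelicMetaplecticScalarTwist`.) -/
theorem isLFContinuous_smul_of {M : ↥(piSchwartzBruhat K ι) →ₗ[ℂ] ↥(piSchwartzBruhat K ι)} (hM : IsLFContinuous M) (c : ℂ) :
    IsLFContinuous (c • M) := by
  intro Φf
  obtain ⟨κ, _, A, Ψ, h⟩ := hM Φf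
  refine ⟨κ, inferInstance, fun j => c • A j, Ψ, fun φ => ?_⟩
  rw [LinearMap.smul_apply, h, Finset.smul_sum]
  refine Finset.sum_congr rfl fun j _ => ?_
  show c • piSchwartzBruhatEquiv K ι (A j φ ⊗ₜ Ψ j) = piSchwartzBruhatEquiv K ι ((c • A j φ) ⊗ₜ Ψ j)
  rw [← TensorProduct.smul_tmul', map_smul]

end LF

section PairRep

variable (L : Type) [Field L] [NumberField L] [IsCMField L] {N M n : ℕ} (e : Fin N × Fin M ≃ Fin n) (dV : Fin N → L)
  (hdV : ∀ i, IsCMField.complexConj L (dV i) = dV i) (hdV0 : ∀ i, dV i ≠ 0) (dW : Fin M → L)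
  (hdW : ∀ i, IsCMField.complexConj L (dW i) = dW i) (hdW0 : ∀ i, dW i ≠ 0)
  (hGR : (cmSplittingDatum L e dV hdV hdV0 dW hdW hdW0).CompatibleSplitting)

/-- **The Weil representation of a CM unitary dual pair acts by LF-continuous operators**: `cmPairRep … p = ω_ψ(s_pair p)` (rfl) with
`s_pair p ∈ Mp_ψ(W_𝔸)ᶜᵒⁿᵗ`, whose elements are LF-continuous by definition (`adelicMpCont.isLFContinuous_omega`). -/
theorem isLFContinuous_cmPairRep
    (p : ↥(UnitaryGroup.adelic (↥(maximalRealSubfield L)) L (IsCMField.complexConj L) N (Matrix.diagonal dV)) ×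
      ↥(UnitaryGroup.adelic (↥(maximalRealSubfield L)) L (IsCMField.complexConj L) M (Matrix.diagonal dW))) :
    IsLFContinuous (cmPairRep L e dV hdV hdV0 dW hdW hdW0 hGR p) :=
  (adelicMpCont.isLFContinuous_omega _).congr (cmPairRep_apply L e dV hdV hdV0 dW hdW hdW0 hGR p)

end PairRep

namespace ArchSideTerm

/-! ## §2 LF-continuity of the four S-side line representations -/

section Lines

variable {L : CMField} {ι₁ : L →+* ℂ} (V : HermSpace3 L ι₁) (S : StubTree.SeesawDatum L)
  (hGR : (cmSplittingDatum (L : Type) finProdFinEquiv (frameD V) (frameD_real V) (frameD_ne V) (dW S) (dW_real S) (dW_ne S)).CompatibleSplitting)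
  (hGR₀ : (cmSplittingDatum (L : Type) (e₁) (frameD V) (frameD_real V) (frameD_ne V) (lineVec (L : Type) (dW S 0))
    (fun _ => dW_real S 0) (fun _ => dW_ne S 0)).CompatibleSplitting)
  (hGR₁ : (cmSplittingDatum (L : Type) (e₁) (frameD V) (frameD_real V) (frameD_ne V) (lineVec (L : Type) (dW S 1))
    (fun _ => dW_real S 1) (fun _ => dW_ne S 1)).CompatibleSplitting)
  (hGR₂ : (cmSplittingDatum (L : Type) (e₁) (frameD V) (frameD_real V) (frameD_ne V) (lineVec (L : Type) (dW' S 0))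
    (fun _ => dW'_real S 0) (fun _ => dW'_ne S 0)).CompatibleSplitting)
  (hGR₃ : (cmSplittingDatum (L : Type) (e₁) (frameD V) (frameD_real V) (frameD_ne V) (lineVec (L : Type) (dW' S 1))
    (fun _ => dW'_real S 1) (fun _ => dW'_ne S 1)).CompatibleSplitting)
  (η₀ η₁ η₂ η₃ : CMAdelic (L : Type) (frameD V) × CMAdelicOne (L : Type) →* ℂˣ)

/-- **Each of the four line representations `lineRep … k` acts by LF-continuous operators** (any η-split). -/
theorem isLFContinuous_lineRep (k : Fin 4)
    (p : CMAdelic (L : Type) (frameD V) × ↥(Literature.NumberTheory.Automorphic.relNormOneIdeles (↥(maximalRealSubfield L)) L)) :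
    IsLFContinuous (lineRep V S hGR hGR₀ hGR₁ hGR₂ hGR₃ η₀ η₁ η₂ η₃ k p) := by
  obtain ⟨v, t⟩ := p
  fin_cases k
  · exact (isLFContinuous_smul_of (isLFContinuous_cmPairRep (L : Type) e₁ (frameD V) (frameD_real V) (frameD_ne V)
        (lineVec (L : Type) (dW S 0)) (fun _ => dW_real S 0) (fun _ => dW_ne S 0) hGR₀ _) _).congr
      (cmLineRepFin₀_apply_eq_smul_cmPairRep (L : Type) finProdFinEquiv e₁ (frameD V) (frameD_real V) (frameD_ne V)
        (dW S) (dW_real S) (dW_ne S) hGR hGR₀ hGR₁ η₀ v t)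
  · exact (isLFContinuous_smul_of (isLFContinuous_cmPairRep (L : Type) e₁ (frameD V) (frameD_real V) (frameD_ne V)
        (lineVec (L : Type) (dW S 1)) (fun _ => dW_real S 1) (fun _ => dW_ne S 1) hGR₁ _) _).congr
      (cmLineRepFin₁_apply_eq_smul_cmPairRep (L : Type) finProdFinEquiv e₁ (frameD V) (frameD_real V) (frameD_ne V)
        (dW S) (dW_real S) (dW_ne S) hGR hGR₀ hGR₁ η₁ v t)
  · exact (isLFContinuous_smul_of (isLFContinuous_cmPairRep (L : Type) e₁ (frameD V) (frameD_real V) (frameD_ne V)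
        (lineVec (L : Type) (dW' S 0)) (fun _ => dW'_real S 0) (fun _ => dW'_ne S 0) hGR₂ _) _).congr
      (cmConjLineRepFin₀_apply_eq_smul_cmPairRep (L : Type) finProdFinEquiv e₁ (frameD V) (frameD_real V) (frameD_ne V)
        (dW S) (dW_real S) (dW_ne S) (dW' S) (dW'_real S) (dW'_ne S) S.isoGL (isoGL_hg₀ S) hGR hGR₂ hGR₃ η₂ v t)
  · exact (isLFContinuous_smul_of (isLFContinuous_cmPairRep (L : Type) e₁ (frameD V) (frameD_real V) (frameD_ne V)
        (lineVec (L : Type) (dW' S 1)) (fun _ => dW'_real S 1) (fun _ => dW'_ne S 1) hGR₃ _) _).congr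
      (cmConjLineRepFin₁_apply_eq_smul_cmPairRep (L : Type) finProdFinEquiv e₁ (frameD V) (frameD_real V) (frameD_ne V)
        (dW S) (dW_real S) (dW_ne S) (dW' S) (dW'_real S) (dW'_ne S) S.isoGL (isoGL_hg₀ S) hGR hGR₂ hGR₃ η₃ v t)

/-- … pulled back to the S pin's group `regimeSubgroup × ker N` (`lineRepOf`). -/
theorem isLFContinuous_lineRepOf (k : Fin 4)
    (g : ↥(regimeSubgroup L V.Hm) × ↥(NumberField.relNormOneIdeles (↥(maximalRealSubfield L)) L)) :
    IsLFContinuous (lineRepOf V S hGR hGR₀ hGR₁ hGR₂ hGR₃ η₀ η₁ η₂ η₃ k g) :=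
  isLFContinuous_lineRep V S hGR hGR₀ hGR₁ hGR₂ hGR₃ η₀ η₁ η₂ η₃ k _

variable (η : CMAdelic (L : Type) (frameD V) × CMAdelic (L : Type) (dW S) →* ℂˣ)

/-- **LF-continuity of `lineRepD … k`** (the DEFAULT η-split) — the honest-branch input `hLF` of `ThetaAdelicSideInstance` §3. -/
theorem isLFContinuous_lineRepD (k : Fin 4)
    (g : ↥(regimeSubgroup L V.Hm) × ↥(NumberField.relNormOneIdeles (↥(maximalRealSubfield L)) L)) :
    IsLFContinuous (lineRepD V S hGR hGR₀ hGR₁ hGR₂ hGR₃ η k g) :=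
  isLFContinuous_lineRepOf V S hGR hGR₀ hGR₁ hGR₂ hGR₃ _ _ _ _ k g

end Lines

/-! ## §3 Rows `hLF` / 13 `hT` at period-1's term and at the total term -/

section Term

variable {L : CMField} {ι₁ : L →+* ℂ} (V : HermSpace3 L ι₁) (c : SeesawCtx L)
  (hGR : (cmSplittingDatum (L : Type) finProdFinEquiv (frameD V) (frameD_real V) (frameD_ne V) (dW c.D) (dW_real c.D)
    (dW_ne c.D)).CompatibleSplitting)
  (hGR₀ : (cmSplittingDatum (L : Type) (e₁) (frameD V) (frameD_real V) (frameD_ne V) (lineVec (L : Type) (dW c.D 0))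
    (fun _ => dW_real c.D 0) (fun _ => dW_ne c.D 0)).CompatibleSplitting)
  (hGR₁ : (cmSplittingDatum (L : Type) (e₁) (frameD V) (frameD_real V) (frameD_ne V) (lineVec (L : Type) (dW c.D 1))
    (fun _ => dW_real c.D 1) (fun _ => dW_ne c.D 1)).CompatibleSplitting)
  (hGR₂ : (cmSplittingDatum (L : Type) (e₁) (frameD V) (frameD_real V) (frameD_ne V) (lineVec (L : Type) (dW' c.D 0))
    (fun _ => dW'_real c.D 0) (fun _ => dW'_ne c.D 0)).CompatibleSplitting)
  (hGR₃ : (cmSplittingDatum (L : Type) (e₁) (frameD V) (frameD_real V) (frameD_ne V) (lineVec (L : Type) (dW' c.D 1))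
    (fun _ => dW'_real c.D 1) (fun _ => dW'_ne c.D 1)).CompatibleSplitting)
  (η : CMAdelic (L : Type) (frameD V) × CMAdelic (L : Type) (dW c.D) →* ℂˣ)
  (hη : ∀ γU ∈ CMRat (L : Type) (frameD V), ∀ γ ∈ CMRat (L : Type) (dW c.D), η (γU, γ) = 1)
  (hηc : Continuous fun p => ((η p : ℂˣ) : ℂ))

/-- **`hLF` at period-1's term**: the pair actions of `archSideOf V c … h₁W A` are LF-continuous (any `h₁W`, `A`). -/
theorem isLFAction_archSideOf (h₁W : (∀ j, 0 < (ι₁ (dW c.D j)).re) ∨ ∀ j, (ι₁ (dW c.D j)).re < 0)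
    (A : ∀ k : Fin 4, ArchLineInput V (lineRepD V c.D hGR hGR₀ hGR₁ hGR₂ hGR₃ η k)) (k : Fin 4) :
    ((archSideOf V c hGR hGR₀ hGR₁ hGR₂ hGR₃ η hη hηc h₁W A).P k).IsLFAction :=
  fun g => isLFContinuous_lineRepD V c.D hGR hGR₀ hGR₁ hGR₂ hGR₃ η k g

/-- **Row 13 `hT` at period-1's term.** -/
theorem isThetaArchContinuous_archSideOf (h₁W : (∀ j, 0 < (ι₁ (dW c.D j)).re) ∨ ∀ j, (ι₁ (dW c.D j)).re < 0)
    (A : ∀ k : Fin 4, ArchLineInput V (lineRepD V c.D hGR hGR₀ hGR₁ hGR₂ hGR₃ η k)) (k : Fin 4) (N : ℕ) :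
    ((archSideOf V c hGR hGR₀ hGR₁ hGR₂ hGR₃ η hη hηc h₁W A).P k).IsThetaArchContinuous N :=
  ((archSideOf V c hGR hGR₀ hGR₁ hGR₂ hGR₃ η hη hηc h₁W A).P k).isThetaArchContinuous_of_isLFContinuous
    (isLFAction_archSideOf V c hGR hGR₀ hGR₁ hGR₂ hGR₃ η hη hηc h₁W A k) N

variable (A : ∀ k : Fin 4, ArchLineInput V (lineRepD V c.D hGR hGR₀ hGR₁ hGR₂ hGR₃ η k))

/-- **`hLF` at the TOTAL term** (both branches). -/
theorem isLFAction_thetaAdelicSideOf (k : Fin 4) :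
    ((thetaAdelicSideOf V c hGR hGR₀ hGR₁ hGR₂ hGR₃ η hη hηc A).P k).IsLFAction :=
  isLFAction_thetaAdelicSideOf_of V c hGR hGR₀ hGR₁ hGR₂ hGR₃ η hη hηc A
    (fun k g => isLFContinuous_lineRepD V c.D hGR hGR₀ hGR₁ hGR₂ hGR₃ η k g) k

/-- **Row 13 `hT` at the TOTAL term** (both branches). -/
theorem isThetaArchContinuous_thetaAdelicSideOf (k : Fin 4) (N : ℕ) :
    ((thetaAdelicSideOf V c hGR hGR₀ hGR₁ hGR₂ hGR₃ η hη hηc A).P k).IsThetaArchContinuous N :=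
  isThetaArchContinuous_thetaAdelicSideOf_of V c hGR hGR₀ hGR₁ hGR₂ hGR₃ η hη hηc A
    (fun k g => isLFContinuous_lineRepD V c.D hGR hGR₀ hGR₁ hGR₂ hGR₃ η k g) k N

end Term

end ArchSideTerm

/-! ## §4 E's binders `hLF` / `hT` at the family, hypothesis-free -/

namespace SInstance

open HodgeCM.Model.ArchSideTerm

variable
  (hGR : ∀ {L : CMField} {ι₁ : L →+* ℂ} (V : HermSpace3 L ι₁) (c : SeesawCtx L),
    (cmSplittingDatum (L : Type) finProdFinEquiv (frameD V) (frameD_real V) (frameD_ne V) (dW c.D) (dW_real c.D)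
      (dW_ne c.D)).CompatibleSplitting)
  (η : ∀ {L : CMField} {ι₁ : L →+* ℂ} (V : HermSpace3 L ι₁) (c : SeesawCtx L),
    CMAdelic (L : Type) (frameD V) × CMAdelic (L : Type) (dW c.D) →* ℂˣ)
  (hη : ∀ {L : CMField} {ι₁ : L →+* ℂ} (V : HermSpace3 L ι₁) (c : SeesawCtx L),
    ∀ γU ∈ CMRat (L : Type) (frameD V), ∀ γ ∈ CMRat (L : Type) (dW c.D), η V c (γU, γ) = 1)
  (hηc : ∀ {L : CMField} {ι₁ : L →+* ℂ} (V : HermSpace3 L ι₁) (c : SeesawCtx L), Continuous fun p => ((η V c p : ℂˣ) : ℂ))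
  (hGR₀ : ∀ {L : CMField} {ι₁ : L →+* ℂ} (V : HermSpace3 L ι₁) (c : SeesawCtx L),
    (cmSplittingDatum (L : Type) (e₁) (frameD V) (frameD_real V) (frameD_ne V) (lineVec (L : Type) (dW c.D 0))
      (fun _ => dW_real c.D 0) (fun _ => dW_ne c.D 0)).CompatibleSplitting)
  (hGR₁ : ∀ {L : CMField} {ι₁ : L →+* ℂ} (V : HermSpace3 L ι₁) (c : SeesawCtx L),
    (cmSplittingDatum (L : Type) (e₁) (frameD V) (frameD_real V) (frameD_ne V) (lineVec (L : Type) (dW c.D 1))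
      (fun _ => dW_real c.D 1) (fun _ => dW_ne c.D 1)).CompatibleSplitting)
  (hGR₂ : ∀ {L : CMField} {ι₁ : L →+* ℂ} (V : HermSpace3 L ι₁) (c : SeesawCtx L),
    (cmSplittingDatum (L : Type) (e₁) (frameD V) (frameD_real V) (frameD_ne V) (lineVec (L : Type) (dW' c.D 0))
      (fun _ => dW'_real c.D 0) (fun _ => dW'_ne c.D 0)).CompatibleSplitting)
  (hGR₃ : ∀ {L : CMField} {ι₁ : L →+* ℂ} (V : HermSpace3 L ι₁) (c : SeesawCtx L),
    (cmSplittingDatum (L : Type) (e₁) (frameD V) (frameD_real V) (frameD_ne V) (lineVec (L : Type) (dW' c.D 1))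
      (fun _ => dW'_real c.D 1) (fun _ => dW'_ne c.D 1)).CompatibleSplitting)
  (A : ∀ {L : CMField} {ι₁ : L →+* ℂ} (V : HermSpace3 L ι₁) (c : SeesawCtx L) (k : Fin 4),
    ArchLineInput V (lineRepD V c.D (hGR V c) (hGR₀ V c) (hGR₁ V c) (hGR₂ V c) (hGR₃ V c) (η V c) k))

/-- **E's binder `hLF` at the family `SInstance.S …`**, hypothesis-free. -/
theorem hLF : ∀ {L : CMField} {ι₁ : L →+* ℂ} (V : HermSpace3 L ι₁) (c : SeesawCtx L) (k : Fin 4),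
    ((S @hGR @η @hη @hηc @hGR₀ @hGR₁ @hGR₂ @hGR₃ @A V c).P k).IsLFAction :=
  fun V c k => isLFAction_thetaAdelicSideOf V c _ _ _ _ _ _ _ _ _ k

/-- **E's row-13 binder `hT` at the family `SInstance.S …`**, hypothesis-free: `∀ V c k N, ((S V c).P k).IsThetaArchContinuous N`. -/
theorem hT : ∀ {L : CMField} {ι₁ : L →+* ℂ} (V : HermSpace3 L ι₁) (c : SeesawCtx L) (k : Fin 4) (N : ℕ),
    ((S @hGR @η @hη @hηc @hGR₀ @hGR₁ @hGR₂ @hGR₃ @A V c).P k).IsThetaArchContinuous N :=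
  fun V c k N => isThetaArchContinuous_thetaAdelicSideOf V c _ _ _ _ _ _ _ _ _ k N

end SInstance

end HodgeCM.Model

end
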